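import Literature.Computability.QuantumComplexity.PauliGates
import Literature.MathematicalPhysics.QuantumLattice.TracePowerInequalities
import Mathlib.Algebra.BigOperators.Fin
import Mathlib.Data.Fin.Tuple.Basic
import Mathlib.LinearAlgebra.Matrix.Kronecker
import HarnessLib

/-!
# The Pauli path integral of a noisy layered circuit (Aharonov–Gao–Landau–Liu–Vazirani 2023, §2)

Topic `Literature/Computability/QuantumComplexity` (pub-qadeq lane: the mechanism behind the
'THEOREM-CLOSED' status vocabulary of the random-circuit-sampling rows E-01…E-10 of CLAIMS §5 —
"noise damps high-degree Pauli-path components" — and the frame of the sparse-Pauli classical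
methods (SPD / LOWESA / Pauli-path truncation) quoted in the utility-type rows E-44 / E-47).

HONEST FRAMING: instance-level adjudication of specific advantage claims; no claim about BQP vs
BPP or the summit. This file proves the DETERMINISTIC identities of §2 of the source for an
arbitrary finite register and arbitrary layer matrices; it says nothing about random circuits,
anti-concentration, the truncation error `2^{-Ω(ℓ)}` (which needs the gate-set orthogonality of
§2, Lemmas 1–3, i.e. Haar / Pauli-twirled randomness) or the running time of any algorithm.

## Source and what is formalised

D. Aharonov, X. Gao, Z. Landau, Y. Liu, U. Vazirani, *A polynomial-time classical algorithm for
noisy random circuit sampling*, STOC 2023, 945–957 = arXiv:2211.03999 [AharonovEtAl2023], §2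
"The Pauli basis framework" (read via `lit read arxiv:2211.03999`, tex chunks p0004 and p0007):

* Definition 1 (Pauli path integral): for `C = U_d ⋯ U_1`,
  `p(C,x) = Σ_{s_0,…,s_d ∈ 𝒫_n} ⟨⟨x|s_d⟩⟩⟨⟨s_d|𝒰_d|s_{d-1}⟩⟩ ⋯ ⟨⟨s_1|𝒰_1|s_0⟩⟩⟨⟨s_0|0ⁿ⟩⟩`, the
  summand being the Fourier coefficient `f(C,s,x)`, with `𝒫_n = {I/√2, X/√2, Y/√2, Z/√2}^{⊗n}`
  the normalised Pauli operators and `𝒰(ρ) = U ρ U†`;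
* Definition 2 (noisy circuits): with `ℰ(ρ) := (1−γ)ρ + γ (I/2) Tr ρ` the single-qubit
  depolarizing noise, "It has the property that `ℰ(I) = I` and `ℰ(P) = (1−γ)P` when
  `P ∈ {X,Y,Z}`", the noisy output distribution is
  `p̃(C,x) = ⟨⟨x| ℰ^{⊗n} 𝒰_d ℰ^{⊗n} ⋯ 𝒰_1 ℰ^{⊗n} |0ⁿ⟩⟩ = Σ_s f̃(C,s,x)` with
  `f̃(C,s,x) := ⟨⟨x|ℰ^{⊗n}|s_d⟩⟩⟨⟨s_d|𝒰_d ℰ^{⊗n}|s_{d-1}⟩⟩ ⋯ ⟨⟨s_1|𝒰_1 ℰ^{⊗n}|s_0⟩⟩⟨⟨s_0|0ⁿ⟩⟩`;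
* "Let `|s|` be the Hamming weight of `s` (the number of non-identity Pauli in `s`). The definition
  of depolarizing noise implies that `f̃(C,s,x) = (1−γ)^{|s|} f(C,s,x)`" (the display after
  Definition 2), hence `p̃(C,x) = Σ_s (1−γ)^{|s|} f(C,s,x)` (the first display of §1.1);
* "The Fourier coefficients satisfy `f(C,s,x) ∈ ℝ` and `|f(C,s,x)| ≤ 1/2ⁿ` … In addition, the
  output `x` only affects the sign of the Fourier coefficient, as `f(C,s,x)² = f(C,s,0ⁿ)²`."

In the tree's vocabulary (`PauliExpansion.lean`: UNNORMALISED strings `pauliString S = ⊗ᵢ σ_{Sᵢ}`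
on a register `ι → Bool`, `pauliCoeff M S = Tr(S·M)`, `Tr(S S') = 2^{|ι|}[S = S']`) every bracket
`⟨⟨s|M⟩⟩ = Tr(S M)/√(2^{|ι|})`, so a path of length `d+1` carries the factor `(2^{|ι|})^{-(d+1)}`
(`PauliPath.pathCoeff`). The layers `U_t` are ARBITRARY matrices on the register (the identities
are algebraic; unitarity is only used for the bound `|f| ≤ 2^{-n}`), the input `ρ` and the
read-out `O` are arbitrary matrices (the printed case is `ρ = |0ⁿ⟩⟨0ⁿ|`, `O = |x⟩⟨x|`,
`PauliPath.proj`). The `n`-qubit noise layer `ℰ^{⊗n}` is `PauliPath.depolarizeAll γ`, the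
composite over all wires of the tree's one-wire depolarizing map in its Pauli-twirl form
`N ↦ (1−γ)N + γ·¼Σ_Q σ_Q^{(j)} N σ_Q^{(j)}` [cite: KempeEtAl2010, Observation 4]; it is
CHARACTERISED by the printed property — `depolarizeAll_pauliString`: `ℰ^{⊗n}(S) = (1−γ)^{|S|} S` —
and any additive homogeneous map with that action on the Pauli strings equals it
(`PauliPath.eq_depolarizeAll`), so the choice of presentation is immaterial.

## Contents (all proved, 0 named facts)

* `PauliPath.strWeight`, `PauliPath.pathWeight` — `|S|`, `|s| = Σ_t |s_t|`.
* Completeness of the Pauli strings: `PauliPath.eq_inv_smul_sum_pauliCoeff_smul`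
  (`M = 2^{-|ι|} Σ_S Tr(S M) S`), `PauliPath.eq_of_forall_pauliCoeff_eq`,
  `PauliPath.trace_mul_eq_inv_mul_sum` (`Tr(A M) = 2^{-|ι|} Σ_S Tr(A S) Tr(S M)`).
* `PauliPath.depolarizeWire`, `PauliPath.depolarizeAll` with additivity / homogeneity,
  `pauliCoeff_depolarizeAll` (`Tr(S·ℰ^{⊗n}M) = (1−γ)^{|S|} Tr(S M)`), `depolarizeAll_pauliString`,
  `depolarizeAll_rate_zero` (`γ = 0` is the identity), `eq_depolarizeAll` (uniqueness).
* `PauliPath.noisyEvolve γ U ρ` (the state `𝒰_d ℰ ⋯ 𝒰_1 ℰ (ρ)`), `PauliPath.noisyValue γ U ρ O`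
  (`Tr(O · ℰ(noisyEvolve))` = `⟨⟨O|ℰ 𝒰_d ℰ ⋯ 𝒰_1 ℰ|ρ⟩⟩`), `PauliPath.transAmp`,
  `PauliPath.pathCoeff` (`f̃(C,s,·)` in unnormalised strings) and the main identities:
  `noisyValue_eq_sum_pathCoeff` (Definitions 1–2: the value IS the path sum, any `γ`),
  `pathCoeff_eq_pow_mul_pathCoeff_zero` (`f̃ = (1−γ)^{|s|} f`, the display after Definition 2),
  `noisyValue_eq_sum_pow_mul_pathCoeff_zero` (§1.1's `p̃ = Σ_s (1−γ)^{|s|} f`), and at `γ = 0` the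
  noiseless circuit:
  `noisyEvolve_rate_zero` (`= U_d⋯U_1 ρ (U_d⋯U_1)†`), `noisyValue_rate_zero_proj_pure`
  (`p(C,x) = |⟨x|U_d⋯U_1|ψ⟩|²` for a pure input).
* The three printed properties of the Fourier coefficients (paragraph after Definition 2):
  `conj_pathCoeff_zero` / `pathCoeff_zero_im` (`f(C,s,x) ∈ ℝ` for Hermitian read-out and input,
  any layer matrices), `norm_pathCoeff_zero_proj_le` (`|f(C,s,x)| ≤ 2^{-|ι|}` for UNITARY layers,
  basis-state input and read-out; via `norm_transAmp_zero_le`: `|Tr(T·USU†)| ≤ 2^{|ι|}` by the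
  tree's Hilbert–Schmidt Cauchy–Schwarz), `pathCoeff_zero_proj_sq` (`f(C,s,x)² = f(C,s,y)²`: the
  read-out basis state only affects the sign).
* Lemma 2 (gate-set orthogonality), finite core: `pauliString_conj_pauliString`
  (`V S V = (∏ sign(Vᵢ,Sᵢ)) S`), `sum_sign_mul_sign` / `sum_prod_sign_mul_prod_sign` (character
  orthogonality `Σ_V sign_V(P) sign_V(Q) = 4^{|ι|}[P = Q]`), `sum_conj_kronecker_conj_eq_zero`
  (the display of the proof: `Σ_V VPV ⊗ VQV = 0` for `P ≠ Q`), `sum_conj_kronecker_conj_eq_zero_of_twirl`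
  (the Pauli-twirled ensemble `U·V`), and the scalar forms `sum_trace_conj_mul_trace_conj_eq_zero` /
  `…_self` (products of two transition brackets average to `0` / to the full weight). The Haar
  statements (Lemma 1) and Lemma 3 / anti-concentration are NOT formalised.

## References

* [AharonovEtAl2023] D. Aharonov, X. Gao, Z. Landau, Y. Liu, U. Vazirani, STOC 2023, 945–957,
  doi:10.1145/3564246.3585234, arXiv:2211.03999 — §1.1 "Description of algorithm" (first
  display), §2 "The Pauli basis framework": Table 1, Definitions 1–2, the paragraph following
  Definition 2, and Lemma 2 with its proof (displays are cited by name/position; the held text is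
  the tex source, whose equation numbers are not visible).
* [KempeEtAl2010] J. Kempe, O. Regev, F. Unger, R. de Wolf, Quantum Inf. Comput. 10 (2010)
  361–376, Observation 4 (depolarizing noise in the Pauli basis) — the tree's `PauliLocal.lean` /
  `PauliGates.lean` (`pauliCoeff_foldl_depolarize`), reused here.
-/

noncomputable section

open Matrix Finset

namespace Literature.Computability.QuantumComplexity

namespace PauliPath

variable {ι : Type*} [Fintype ι] [DecidableEq ι]

/-! ### Hamming weights -/

/-- The Hamming weight `|S|` of a Pauli string: the number of non-identity letters.
[cite: AharonovEtAl2023, §2 (after Definition 2: "the number of non-identity Pauli in s")] -/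
def strWeight (S : ι → Pauli) : ℕ :=
  (Finset.univ.filter fun i => S i ≠ Pauli.I).card

omit [DecidableEq ι] in
/-- Unfolding of `strWeight`. [cite: AharonovEtAl2023, §2 (after Definition 2: Hamming weight)] -/
theorem strWeight_eq (S : ι → Pauli) :
    strWeight S = (Finset.univ.filter fun i => S i ≠ Pauli.I).card := rfl

omit [DecidableEq ι] in
/-- The identity string has weight `0` (the all-identity path is the unique path of weight `0`).
[cite: AharonovEtAl2023, §2 (proof of Lemma 4: "W_0 = 1 corresponds to the unique all-identity path")] -/
@[simp] theorem strWeight_const_I : strWeight (fun _ : ι => Pauli.I) = 0 := by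
  simp [strWeight]

/-- The Hamming weight `|s| = Σ_t |s_t|` of a Pauli path `s = (s_0, …, s_d)`.
[cite: AharonovEtAl2023, §2 (after Definition 2)] -/
def pathWeight {d : ℕ} (s : Fin (d + 1) → ι → Pauli) : ℕ :=
  ∑ t, strWeight (s t)

omit [DecidableEq ι] in
/-- Unfolding of `pathWeight`. [cite: AharonovEtAl2023, §2 (after Definition 2: |s|)] -/
theorem pathWeight_eq {d : ℕ} (s : Fin (d + 1) → ι → Pauli) :
    pathWeight s = ∑ t, strWeight (s t) := rfl

/-! ### Completeness of the Pauli strings (the operator basis `𝒫_n`) -/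

/-- Entrywise completeness in coefficient form: `Σ_S Tr(S M) · S_{ab} = 2^{|ι|} M_{ab}`.
[cite: AharonovEtAl2023, §2 (Table 1: 𝒫_n is an orthonormal operator basis)] -/
theorem sum_pauliCoeff_mul_apply (M : Matrix (ι → Bool) (ι → Bool) ℂ) (a b : ι → Bool) :
    ∑ S : ι → Pauli, pauliCoeff M S * pauliString S a b = (2 : ℂ) ^ Fintype.card ι * M a b := by
  have hc : ∀ S : ι → Pauli, pauliCoeff M S = ∑ x, ∑ y, pauliString S x y * M y x := by
    intro S
    rw [pauliCoeff_eq, Matrix.trace]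
    simp only [Matrix.diag_apply, Matrix.mul_apply]
  have h1 : ∀ S : ι → Pauli, pauliCoeff M S * pauliString S a b =
      ∑ x, ∑ y, M y x * (pauliString S x y * pauliString S a b) := by
    intro S
    rw [hc, Finset.sum_mul]
    refine Finset.sum_congr rfl fun x _ => ?_
    rw [Finset.sum_mul]
    exact Finset.sum_congr rfl fun y _ => by ring
  simp only [h1]
  calc ∑ S : ι → Pauli, ∑ x, ∑ y, M y x * (pauliString S x y * pauliString S a b)
      = ∑ x, ∑ y, ∑ S : ι → Pauli, M y x * (pauliString S x y * pauliString S a b) := by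
        rw [Finset.sum_comm]
        exact Finset.sum_congr rfl fun x _ => Finset.sum_comm
    _ = ∑ x, ∑ y, M y x * ∑ S : ι → Pauli, pauliString S x y * pauliString S a b := by
        simp only [Finset.mul_sum]
    _ = ∑ x, ∑ y, (if x = b then (if y = a then M y x * (2 : ℂ) ^ Fintype.card ι else 0)
          else 0) := by
        refine Finset.sum_congr rfl fun x _ => Finset.sum_congr rfl fun y _ => ?_
        rw [sum_pauliString_apply_mul_apply x y b a]
        by_cases hx : x = b
        · by_cases hy : y = a
          · simp [hx, hy]
          · simp [hx, hy]
        · simp [hx]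
    _ = (2 : ℂ) ^ Fintype.card ι * M a b := by
        rw [Finset.sum_eq_single b]
        · simp only [if_true]
          rw [Finset.sum_eq_single a]
          · rw [if_pos rfl, mul_comm]
          · intro y _ hy; rw [if_neg hy]
          · intro h; exact absurd (Finset.mem_univ a) h
        · intro x _ hx
          simp only [if_neg hx, Finset.sum_const_zero]
        · intro h; exact absurd (Finset.mem_univ b) h

/-- **The Pauli expansion** `M = 2^{-|ι|} Σ_S Tr(S M) S` of every matrix on the register: the
Pauli strings are an operator basis ("decompose a density matrix into a linear combination of Pauli
operators", `ρ = Σ_{s ∈ 𝒫_n} α_s s`, `α_s = Tr(sρ)`). (The same statement is proved as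
`mb_pauli_expansion` in a `Summits/QuantumAdvantage/…` theorems file, which `Literature/` cannot
import; this is the Literature-side copy, same proof.) [cite: AharonovEtAl2023, §1.1 and §2 (Table 1)] -/
theorem eq_inv_smul_sum_pauliCoeff_smul (M : Matrix (ι → Bool) (ι → Bool) ℂ) :
    M = ((2 : ℂ) ^ Fintype.card ι)⁻¹ • ∑ S : ι → Pauli, pauliCoeff M S • pauliString S := by
  ext a b
  have h2 : ((2 : ℂ) ^ Fintype.card ι) ≠ 0 := pow_ne_zero _ two_ne_zero
  simp only [Matrix.smul_apply, Matrix.sum_apply, smul_eq_mul, sum_pauliCoeff_mul_apply]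
  field_simp

/-- Two matrices with the same Pauli coefficients are equal. [cite: AharonovEtAl2023, §2 (Table 1: 𝒫_n is a basis)] -/
theorem eq_of_forall_pauliCoeff_eq {M N : Matrix (ι → Bool) (ι → Bool) ℂ}
    (h : ∀ S, pauliCoeff M S = pauliCoeff N S) : M = N := by
  rw [eq_inv_smul_sum_pauliCoeff_smul M, eq_inv_smul_sum_pauliCoeff_smul N]
  simp only [h]

/-- **Resolution of the identity in the Pauli basis**, trace form:
`Tr(A M) = 2^{-|ι|} Σ_S Tr(A S) Tr(S M)` — the rule `⟨⟨A|M⟩⟩ = Σ_s ⟨⟨A|s⟩⟩⟨⟨s|M⟩⟩` behind the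
path integral. [cite: AharonovEtAl2023, §1.1 (transition rule Tr(sUρU†) = Σ_t Tr(sUtU†)Tr(tρ))] -/
theorem trace_mul_eq_inv_mul_sum (A M : Matrix (ι → Bool) (ι → Bool) ℂ) :
    (A * M).trace = ((2 : ℂ) ^ Fintype.card ι)⁻¹ *
      ∑ S : ι → Pauli, (A * pauliString S).trace * pauliCoeff M S := by
  conv_lhs => rw [eq_inv_smul_sum_pauliCoeff_smul M]
  rw [Matrix.mul_smul, Matrix.trace_smul, smul_eq_mul, Matrix.mul_sum, Matrix.trace_sum]
  congr 1
  refine Finset.sum_congr rfl fun S _ => ?_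
  rw [Matrix.mul_smul, Matrix.trace_smul, smul_eq_mul, mul_comm]

/-! ### The depolarizing layer `ℰ^{⊗n}` -/

/-- One-wire depolarizing noise of rate `γ` at wire `j`, in the Pauli-twirl form
`N ↦ (1 − γ) N + γ · ¼ Σ_Q σ_Q^{(j)} N σ_Q^{(j)}` (`¼ Σ_Q σ_Q ρ σ_Q = (I/2) Tr ρ` on one qubit).
[cite: KempeEtAl2010, Observation 4] -/
def depolarizeWire (γ : ℂ) (j : ι) (N : Matrix (ι → Bool) (ι → Bool) ℂ) :
    Matrix (ι → Bool) (ι → Bool) ℂ :=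
  (1 - γ) • N + γ • ((1 / 4 : ℂ) • ∑ Q,
    pauliString (Function.update (fun _ : ι => Pauli.I) j Q) * N *
      pauliString (Function.update (fun _ : ι => Pauli.I) j Q))

/-- The `n`-qubit noise layer `ℰ^{⊗n}`: every wire of the register depolarized at rate `γ`
(composite of the one-wire maps over an enumeration of the wires; the result does not depend on
the enumeration, see `eq_depolarizeAll`). [cite: AharonovEtAl2023, Definition 2] -/
def depolarizeAll (γ : ℂ) (M : Matrix (ι → Bool) (ι → Bool) ℂ) : Matrix (ι → Bool) (ι → Bool) ℂ :=
  (Finset.univ : Finset ι).toList.foldl (fun N j => depolarizeWire γ j N) M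

/-- `depolarizeWire` is additive (a linear map, as every channel).
[cite: KempeEtAl2010, Observation 4] -/
theorem depolarizeWire_add (γ : ℂ) (j : ι) (M N : Matrix (ι → Bool) (ι → Bool) ℂ) :
    depolarizeWire γ j (M + N) = depolarizeWire γ j M + depolarizeWire γ j N := by
  simp only [depolarizeWire, Matrix.mul_add, Matrix.add_mul, Finset.sum_add_distrib, smul_add]
  abel

/-- `depolarizeWire` is homogeneous. [cite: KempeEtAl2010, Observation 4] -/
theorem depolarizeWire_smul (γ : ℂ) (j : ι) (c : ℂ) (M : Matrix (ι → Bool) (ι → Bool) ℂ) :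
    depolarizeWire γ j (c • M) = c • depolarizeWire γ j M := by
  simp only [depolarizeWire, Matrix.mul_smul, Matrix.smul_mul, ← Finset.smul_sum, smul_add,
    smul_comm c]

/-- At rate `0` the one-wire map is the identity (no noise). [cite: KempeEtAl2010, Observation 4] -/
theorem depolarizeWire_rate_zero (j : ι) (M : Matrix (ι → Bool) (ι → Bool) ℂ) :
    depolarizeWire 0 j M = M := by
  simp [depolarizeWire]

omit [Fintype ι] in
/-- Additivity of a composite of one-wire depolarizing maps. [folklore] -/
private theorem foldl_depolarizeWire_add (γ : ℂ) (L : List ι)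
    (M N : Matrix (ι → Bool) (ι → Bool) ℂ) [Fintype ι] :
    L.foldl (fun N j => depolarizeWire γ j N) (M + N) =
      L.foldl (fun N j => depolarizeWire γ j N) M + L.foldl (fun N j => depolarizeWire γ j N) N := by
  induction L generalizing M N with
  | nil => rfl
  | cons j L ih => simp only [List.foldl_cons, depolarizeWire_add, ih]

omit [Fintype ι] in
/-- Homogeneity of a composite of one-wire depolarizing maps. [folklore] -/
private theorem foldl_depolarizeWire_smul (γ : ℂ) (L : List ι) (c : ℂ)
    (M : Matrix (ι → Bool) (ι → Bool) ℂ) [Fintype ι] :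
    L.foldl (fun N j => depolarizeWire γ j N) (c • M) =
      c • L.foldl (fun N j => depolarizeWire γ j N) M := by
  induction L generalizing M with
  | nil => rfl
  | cons j L ih => simp only [List.foldl_cons, depolarizeWire_smul, ih]

omit [Fintype ι] in
/-- A composite of rate-`0` maps is the identity. [folklore] -/
private theorem foldl_depolarizeWire_rate_zero (L : List ι)
    (M : Matrix (ι → Bool) (ι → Bool) ℂ) [Fintype ι] :
    L.foldl (fun N j => depolarizeWire 0 j N) M = M := by
  induction L generalizing M with
  | nil => rfl
  | cons j L ih =>
    simp only [List.foldl_cons]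
    rw [depolarizeWire_rate_zero, ih]

/-- `ℰ^{⊗n}` is additive. [cite: AharonovEtAl2023, §2 (ℰ defined before Definition 2 is linear)] -/
theorem depolarizeAll_add (γ : ℂ) (M N : Matrix (ι → Bool) (ι → Bool) ℂ) :
    depolarizeAll γ (M + N) = depolarizeAll γ M + depolarizeAll γ N :=
  foldl_depolarizeWire_add γ _ M N

/-- `ℰ^{⊗n}` is homogeneous. [cite: AharonovEtAl2023, §2 (ℰ defined before Definition 2 is linear)] -/
theorem depolarizeAll_smul (γ : ℂ) (c : ℂ) (M : Matrix (ι → Bool) (ι → Bool) ℂ) :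
    depolarizeAll γ (c • M) = c • depolarizeAll γ M :=
  foldl_depolarizeWire_smul γ _ c M

/-- `ℰ^{⊗n}` as a `ℂ`-linear map. [folklore] -/
def depolarizeAllL (γ : ℂ) :
    Matrix (ι → Bool) (ι → Bool) ℂ →ₗ[ℂ] Matrix (ι → Bool) (ι → Bool) ℂ where
  toFun := depolarizeAll γ
  map_add' := depolarizeAll_add γ
  map_smul' := depolarizeAll_smul γ

/-- Unfolding of `depolarizeAllL`. [cite: AharonovEtAl2023, §2 (ℰ defined before Definition 2)] -/
@[simp] theorem depolarizeAllL_apply (γ : ℂ) (M : Matrix (ι → Bool) (ι → Bool) ℂ) :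
    depolarizeAllL γ M = depolarizeAll γ M := rfl

/-- `ℰ^{⊗n}` of a finite linear combination. [cite: AharonovEtAl2023, §2 (ℰ defined before Definition 2 is linear)] -/
theorem depolarizeAll_sum_smul {κ : Type*} (γ : ℂ) (s : Finset κ) (c : κ → ℂ)
    (M : κ → Matrix (ι → Bool) (ι → Bool) ℂ) :
    depolarizeAll γ (∑ k ∈ s, c k • M k) = ∑ k ∈ s, c k • depolarizeAll γ (M k) := by
  have h := map_sum (depolarizeAllL (ι := ι) γ) (fun k => c k • M k) s
  simpa only [depolarizeAllL_apply, map_smul] using h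

/-- **No noise**: at rate `γ = 0` the layer is the identity map (`ℰ(ρ) = (1−0)ρ + 0·(I/2)Tr ρ = ρ`).
[cite: AharonovEtAl2023, §2 (ℰ defined before Definition 2)] -/
theorem depolarizeAll_rate_zero (M : Matrix (ι → Bool) (ι → Bool) ℂ) : depolarizeAll 0 M = M :=
  foldl_depolarizeWire_rate_zero _ M

/-- **Depolarizing noise in the Pauli basis** (`n`-qubit form of Observation 4 / of
"`ℰ(I) = I`, `ℰ(P) = (1−γ)P`"): `Tr(S · ℰ^{⊗n} M) = (1 − γ)^{|S|} Tr(S M)`.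
[cite: AharonovEtAl2023, §2 (after Definition 2)] [cite: KempeEtAl2010, Observation 4] -/
theorem pauliCoeff_depolarizeAll (γ : ℂ) (M : Matrix (ι → Bool) (ι → Bool) ℂ) (S : ι → Pauli) :
    pauliCoeff (depolarizeAll γ M) S = (1 - γ) ^ strWeight S * pauliCoeff M S := by
  have h := pauliCoeff_foldl_depolarize γ (Finset.univ : Finset ι).toList M S
  simp only [depolarizeAll, depolarizeWire]
  rw [h, prod_map_ite_eq_pow (1 - γ) (Finset.nodup_toList _) S, Finset.toList_toFinset,
    strWeight_eq]

/-- **`ℰ^{⊗n}` acts diagonally on the Pauli strings**: `ℰ^{⊗n}(S) = (1 − γ)^{|S|} S` — the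
`n`-qubit form of "`ℰ(I) = I` and `ℰ(P) = (1−γ)P` when `P ∈ {X,Y,Z}`".
[cite: AharonovEtAl2023, §2 (Definition 2 and the sentence before it)] -/
theorem depolarizeAll_pauliString (γ : ℂ) (S : ι → Pauli) :
    depolarizeAll γ (pauliString S) = (1 - γ) ^ strWeight S • pauliString S := by
  refine eq_of_forall_pauliCoeff_eq fun T => ?_
  rw [pauliCoeff_depolarizeAll, pauliCoeff_smul, pauliCoeff_eq, trace_pauliString_mul_pauliString]
  by_cases h : T = S
  · subst h; simp
  · simp [h]

/-- **Uniqueness of the noise layer**: any additive, homogeneous map acting on the Pauli strings by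
`S ↦ (1 − γ)^{|S|} S` IS `ℰ^{⊗n}` (so the enumeration of the wires in `depolarizeAll`, or any
other presentation of the tensor power of the one-qubit channel, gives the same map).
[cite: AharonovEtAl2023, §2 (Table 1: 𝒫_n is a basis; Definition 2)] -/
theorem eq_depolarizeAll (γ : ℂ)
    (Φ : Matrix (ι → Bool) (ι → Bool) ℂ → Matrix (ι → Bool) (ι → Bool) ℂ)
    (hadd : ∀ M N, Φ (M + N) = Φ M + Φ N) (hsmul : ∀ (c : ℂ) M, Φ (c • M) = c • Φ M)
    (hS : ∀ S, Φ (pauliString S) = (1 - γ) ^ strWeight S • pauliString S)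
    (M : Matrix (ι → Bool) (ι → Bool) ℂ) : Φ M = depolarizeAll γ M := by
  -- both sides are determined by the expansion of `M`
  have hΦsum : ∀ (s : Finset (ι → Pauli)) (c : (ι → Pauli) → ℂ),
      Φ (∑ S ∈ s, c S • pauliString S) = ∑ S ∈ s, c S • Φ (pauliString S) := by
    intro s c
    induction s using Finset.induction_on with
    | empty =>
      have h0 : Φ 0 = 0 := by simpa using hsmul 0 0
      simpa using h0
    | insert a s ha ih => rw [Finset.sum_insert ha, Finset.sum_insert ha, hadd, hsmul, ih]
  conv_lhs => rw [eq_inv_smul_sum_pauliCoeff_smul M]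
  conv_rhs => rw [eq_inv_smul_sum_pauliCoeff_smul M]
  rw [hsmul, depolarizeAll_smul, hΦsum, depolarizeAll_sum_smul]
  simp only [hS, depolarizeAll_pauliString]

/-- `ℰ^{⊗n}` through a read-out: `Tr(A · ℰ^{⊗n} M) = 2^{-|ι|} Σ_S Tr(A · ℰ^{⊗n} S) Tr(S M)` (expand `M`
in the Pauli basis and use linearity of the noise layer). [cite: AharonovEtAl2023, §2 (Definition 2)] -/
theorem trace_mul_depolarizeAll (γ : ℂ) (A M : Matrix (ι → Bool) (ι → Bool) ℂ) :
    (A * depolarizeAll γ M).trace = ((2 : ℂ) ^ Fintype.card ι)⁻¹ *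
      ∑ S : ι → Pauli, (A * depolarizeAll γ (pauliString S)).trace * pauliCoeff M S := by
  conv_lhs => rw [eq_inv_smul_sum_pauliCoeff_smul M]
  rw [depolarizeAll_smul, depolarizeAll_sum_smul, Matrix.mul_smul, Matrix.trace_smul, smul_eq_mul,
    Matrix.mul_sum, Matrix.trace_sum]
  congr 1
  refine Finset.sum_congr rfl fun S _ => ?_
  rw [Matrix.mul_smul, Matrix.trace_smul, smul_eq_mul, mul_comm]

/-! ### Noisy layered circuits and their Pauli path integral -/

/-- The state of the noisy circuit after its `d` gate layers `U_0, …, U_{d-1}` (matrices on the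
register, applied in this order), with the noise layer `ℰ^{⊗n}` applied to the input and after every
gate layer except the last: `noisyEvolve γ U ρ = 𝒰_{d-1} ℰ^{⊗n} ⋯ 𝒰_0 ℰ^{⊗n} (ρ)`, `𝒰(M) = U M U†`
(the final noise layer sits in `noisyValue`). [cite: AharonovEtAl2023, Definition 2] -/
def noisyEvolve (γ : ℂ) : (d : ℕ) → (Fin d → Matrix (ι → Bool) (ι → Bool) ℂ) →
    Matrix (ι → Bool) (ι → Bool) ℂ → Matrix (ι → Bool) (ι → Bool) ℂ
  | 0, _, ρ => ρ
  | d + 1, U, ρ =>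
      U (Fin.last d) * depolarizeAll γ (noisyEvolve γ d (fun i => U i.castSucc) ρ) * (U (Fin.last d))ᴴ

/-- No layers: the state is the input. [cite: AharonovEtAl2023, Definition 2] -/
@[simp] theorem noisyEvolve_zero_layers (γ : ℂ) (U : Fin 0 → Matrix (ι → Bool) (ι → Bool) ℂ)
    (ρ : Matrix (ι → Bool) (ι → Bool) ℂ) : noisyEvolve γ 0 U ρ = ρ := rfl

/-- One more layer: noise, then conjugation by the last gate layer `𝒰_d ℰ^{⊗n}(·)`.
[cite: AharonovEtAl2023, Definition 2] -/
theorem noisyEvolve_succ_layers (γ : ℂ) {d : ℕ} (U : Fin (d + 1) → Matrix (ι → Bool) (ι → Bool) ℂ)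
    (ρ : Matrix (ι → Bool) (ι → Bool) ℂ) :
    noisyEvolve γ (d + 1) U ρ = U (Fin.last d) *
      depolarizeAll γ (noisyEvolve γ d (fun i => U i.castSucc) ρ) * (U (Fin.last d))ᴴ := rfl

/-- The noisy value `⟨⟨O| ℰ^{⊗n} 𝒰_{d-1} ℰ^{⊗n} ⋯ 𝒰_0 ℰ^{⊗n} |ρ⟩⟩ = Tr(O · ℰ^{⊗n}(noisyEvolve γ U ρ))`;
for `ρ = |0ⁿ⟩⟨0ⁿ|` and `O = |x⟩⟨x|` this is the printed `p̃(C,x)`.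
[cite: AharonovEtAl2023, Definition 2 (display defining p̃(C,x))] -/
def noisyValue (γ : ℂ) {d : ℕ} (U : Fin d → Matrix (ι → Bool) (ι → Bool) ℂ)
    (ρ O : Matrix (ι → Bool) (ι → Bool) ℂ) : ℂ :=
  (O * depolarizeAll γ (noisyEvolve γ d U ρ)).trace

/-- The transition amplitude of one noisy layer between UNNORMALISED Pauli strings,
`Tr(T · U ℰ^{⊗n}(S) U†) = 2^{|ι|} ⟨⟨t|𝒰 ℰ^{⊗n}|s⟩⟩`. [cite: AharonovEtAl2023, §1.1 and Definition 2] -/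
def transAmp (γ : ℂ) (U : Matrix (ι → Bool) (ι → Bool) ℂ) (S T : ι → Pauli) : ℂ :=
  (pauliString T * (U * depolarizeAll γ (pauliString S) * Uᴴ)).trace

/-- The contribution `f̃(C,s,·)` of the Pauli path `s = (s_0, …, s_d)` (Definition 2, the display
defining `f̃(C,s,x)`), in unnormalised strings:
`(2^{|ι|})^{-(d+1)} · Tr(O ℰ^{⊗n} s_d) · Π_{t<d} Tr(s_{t+1} U_t ℰ^{⊗n}(s_t) U_t†) · Tr(s_0 ρ)`;
at `γ = 0` it is the Fourier coefficient `f(C,s,·)` of Definition 1.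
[cite: AharonovEtAl2023, Definitions 1–2 (displays defining f(C,s,x) and f̃(C,s,x))] -/
def pathCoeff (γ : ℂ) {d : ℕ} (U : Fin d → Matrix (ι → Bool) (ι → Bool) ℂ)
    (ρ O : Matrix (ι → Bool) (ι → Bool) ℂ) (s : Fin (d + 1) → ι → Pauli) : ℂ :=
  (((2 : ℂ) ^ Fintype.card ι)⁻¹) ^ (d + 1) *
    ((O * depolarizeAll γ (pauliString (s (Fin.last d)))).trace *
      (∏ t : Fin d, transAmp γ (U t) (s t.castSucc) (s t.succ)) * (pauliString (s 0) * ρ).trace)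

omit [Fintype ι] [DecidableEq ι] in
/-- Sums over `1`-tuples are sums over the entry. [folklore] -/
private theorem sum_fin_one {α β : Type*} [Fintype α] [AddCommMonoid β] (g : (Fin 1 → α) → β) :
    ∑ s, g s = ∑ a, g (fun _ => a) := by
  refine Fintype.sum_equiv (Equiv.funUnique (Fin 1) α) _ _ (fun s => ?_)
  congr 1
  funext i
  simp [Fin.fin_one_eq_zero i]

omit [Fintype ι] [DecidableEq ι] in
/-- The first entry of `Fin.snoc p x` is the first entry of `p`. [folklore] -/
private theorem snoc_apply_zero {α : Type*} {n : ℕ} (p : Fin (n + 1) → α) (x : α) :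
    (Fin.snoc p x : Fin (n + 2) → α) 0 = p 0 :=
  Fin.snoc_castSucc (α := fun _ => α) x p 0

omit [Fintype ι] [DecidableEq ι] in
/-- `Fin.snocEquiv` on a pair is `Fin.snoc`. [folklore] -/
private theorem snocEquiv_pair {α : Type*} {n : ℕ} (p : Fin n → α) (x : α) :
    (Fin.snocEquiv fun _ => α) (x, p) = Fin.snoc p x := rfl

/-- The read-out bracket after conjugation is a transition amplitude:
`Tr((U† T U) · ℰ^{⊗n} S) = Tr(T · U ℰ^{⊗n}(S) U†)` (cyclicity of the trace).
[cite: AharonovEtAl2023, §1.1 (Tr(s U t U†) "plays the role of transition amplitude from t to s")] -/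
theorem trace_conj_mul_depolarizeAll (γ : ℂ) (U : Matrix (ι → Bool) (ι → Bool) ℂ) (S T : ι → Pauli) :
    (Uᴴ * pauliString T * U * depolarizeAll γ (pauliString S)).trace = transAmp γ U S T := by
  simp only [transAmp, Matrix.mul_assoc]
  rw [Matrix.trace_mul_comm]
  simp only [Matrix.mul_assoc]

/-- Peeling the last layer off a path coefficient: for `s = (s', T)`,
`f̃_{U}(O; s) = 2^{-|ι|} Tr(O ℰ^{⊗n} T) · f̃_{init U}(U_d† T U_d; s')` — the product structure of the
path contribution. [cite: AharonovEtAl2023, Definition 2 (display defining f̃(C,s,x))] -/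
theorem pathCoeff_snoc (γ : ℂ) {d : ℕ} (U : Fin (d + 1) → Matrix (ι → Bool) (ι → Bool) ℂ)
    (ρ O : Matrix (ι → Bool) (ι → Bool) ℂ) (s' : Fin (d + 1) → ι → Pauli) (T : ι → Pauli) :
    pathCoeff γ U ρ O (Fin.snoc s' T) = ((2 : ℂ) ^ Fintype.card ι)⁻¹ *
      (O * depolarizeAll γ (pauliString T)).trace *
        pathCoeff γ (fun i => U i.castSucc) ρ
          ((U (Fin.last d))ᴴ * pauliString T * U (Fin.last d)) s' := by
  simp only [pathCoeff, Fin.prod_univ_castSucc, Fin.snoc_castSucc, Fin.succ_castSucc, Fin.succ_last,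
    Fin.snoc_last, snoc_apply_zero, trace_conj_mul_depolarizeAll]
  ring

/-- **The Pauli path integral** (Definitions 1–2): the noisy value is the sum of
the path contributions over ALL Pauli paths `s = (s_0, …, s_d) ∈ (𝒫_n)^{d+1}`,
`⟨⟨O| ℰ 𝒰_{d-1} ℰ ⋯ 𝒰_0 ℰ |ρ⟩⟩ = Σ_s f̃(C,s,·)`; at `γ = 0` this is Definition 1,
`p(C,x) = Σ_s f(C,s,x)` ("follows from repeatedly applying the rules shown in Table 1").
[cite: AharonovEtAl2023, Definitions 1–2] -/
theorem noisyValue_eq_sum_pathCoeff (γ : ℂ) (ρ : Matrix (ι → Bool) (ι → Bool) ℂ) :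
    ∀ (d : ℕ) (U : Fin d → Matrix (ι → Bool) (ι → Bool) ℂ) (O : Matrix (ι → Bool) (ι → Bool) ℂ),
      noisyValue γ U ρ O = ∑ s : Fin (d + 1) → ι → Pauli, pathCoeff γ U ρ O s := by
  intro d
  induction d with
  | zero =>
    intro U O
    rw [noisyValue, noisyEvolve_zero_layers, trace_mul_depolarizeAll, Finset.mul_sum, sum_fin_one]
    refine Finset.sum_congr rfl fun S _ => ?_
    simp only [pathCoeff, Fin.prod_univ_zero, mul_one, pauliCoeff_eq]
    ring
  | succ d ih =>
    intro U O
    rw [noisyValue, noisyEvolve_succ_layers, trace_mul_depolarizeAll, Finset.mul_sum,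
      ← (Fin.snocEquiv fun _ => (ι → Pauli)).sum_comp, Fintype.sum_prod_type]
    refine Finset.sum_congr rfl fun T _ => ?_
    have hcyc : pauliCoeff (U (Fin.last d) *
        depolarizeAll γ (noisyEvolve γ d (fun i => U i.castSucc) ρ) * (U (Fin.last d))ᴴ) T =
        noisyValue γ (fun i => U i.castSucc) ρ ((U (Fin.last d))ᴴ * pauliString T * U (Fin.last d)) := by
      rw [pauliCoeff_eq, noisyValue]
      simp only [Matrix.mul_assoc]
      rw [Matrix.trace_mul_comm (U (Fin.last d))ᴴ]
      simp only [Matrix.mul_assoc]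
    rw [hcyc, ih, Finset.mul_sum, Finset.mul_sum]
    refine Finset.sum_congr rfl fun s' _ => ?_
    rw [snocEquiv_pair, pathCoeff_snoc]
    ring

/-! ### The damping identity `f̃ = (1 − γ)^{|s|} f` and the noiseless circuit -/

/-- The read-out bracket of a damped string: `Tr(O ℰ^{⊗n} S) = (1−γ)^{|S|} Tr(O S)`.
[cite: AharonovEtAl2023, §2 (display after Definition 2)] -/
theorem trace_mul_depolarizeAll_pauliString (γ : ℂ) (O : Matrix (ι → Bool) (ι → Bool) ℂ)
    (S : ι → Pauli) :
    (O * depolarizeAll γ (pauliString S)).trace = (1 - γ) ^ strWeight S * (O * pauliString S).trace := by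
  rw [depolarizeAll_pauliString, Matrix.mul_smul, Matrix.trace_smul, smul_eq_mul]

/-- One noisy transition amplitude is the noiseless one damped by `(1−γ)^{|s|}`:
`⟨⟨t|𝒰 ℰ^{⊗n}|s⟩⟩ = (1−γ)^{|s|} ⟨⟨t|𝒰|s⟩⟩`.
[cite: AharonovEtAl2023, §2 (display after Definition 2: f̃ = (1−γ)^{|s|} f)] -/
theorem transAmp_eq_pow_mul (γ : ℂ) (U : Matrix (ι → Bool) (ι → Bool) ℂ) (S T : ι → Pauli) :
    transAmp γ U S T = (1 - γ) ^ strWeight S * transAmp 0 U S T := by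
  simp only [transAmp, depolarizeAll_pauliString, Matrix.mul_smul, Matrix.smul_mul,
    Matrix.trace_smul, smul_eq_mul, sub_zero, one_pow, one_mul]

/-- **The damping identity**: "The definition of depolarizing noise implies that
`f̃(C,s,x) = (1−γ)^{|s|} f(C,s,x)`", `|s| = Σ_t |s_t|`.
[cite: AharonovEtAl2023, §2 (display after Definition 2)] -/
theorem pathCoeff_eq_pow_mul_pathCoeff_zero (γ : ℂ) {d : ℕ}
    (U : Fin d → Matrix (ι → Bool) (ι → Bool) ℂ) (ρ O : Matrix (ι → Bool) (ι → Bool) ℂ)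
    (s : Fin (d + 1) → ι → Pauli) :
    pathCoeff γ U ρ O s = (1 - γ) ^ pathWeight s * pathCoeff 0 U ρ O s := by
  have hprod : ∏ t : Fin d, transAmp γ (U t) (s t.castSucc) (s t.succ) =
      (1 - γ) ^ (∑ t : Fin d, strWeight (s t.castSucc)) *
        ∏ t : Fin d, transAmp 0 (U t) (s t.castSucc) (s t.succ) := by
    rw [← Finset.prod_pow_eq_pow_sum, ← Finset.prod_mul_distrib]
    exact Finset.prod_congr rfl fun t _ => transAmp_eq_pow_mul γ (U t) _ _
  rw [pathCoeff, pathCoeff, hprod, trace_mul_depolarizeAll_pauliString, depolarizeAll_rate_zero,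
    pathWeight_eq, Fin.sum_univ_castSucc, pow_add]
  ring

/-- **§1.1, first display**: `p̃(C,x) = Σ_s (1−γ)^{|s|} f(C,s,x)` — the noisy value is the noiseless
path sum with every path damped by its Hamming weight ("the contribution of a Pauli path of a noisy
quantum circuit subject to this noise, decays exponentially with the Hamming weight of the Pauli
path"). [cite: AharonovEtAl2023, §1.1 (first display) and §2 (Definition 2 and the display after it)] -/
theorem noisyValue_eq_sum_pow_mul_pathCoeff_zero (γ : ℂ) {d : ℕ}
    (U : Fin d → Matrix (ι → Bool) (ι → Bool) ℂ) (ρ O : Matrix (ι → Bool) (ι → Bool) ℂ) :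
    noisyValue γ U ρ O =
      ∑ s : Fin (d + 1) → ι → Pauli, (1 - γ) ^ pathWeight s * pathCoeff 0 U ρ O s := by
  rw [noisyValue_eq_sum_pathCoeff]
  exact Finset.sum_congr rfl fun s _ => pathCoeff_eq_pow_mul_pathCoeff_zero γ U ρ O s

/-- The unitary `U_{d-1} ⋯ U_0` of the noiseless circuit (layers applied in order `0, …, d−1`).
[cite: AharonovEtAl2023, Definition 1 (C = U_d U_{d-1} ⋯ U_1)] -/
def circuitUnitary : (d : ℕ) → (Fin d → Matrix (ι → Bool) (ι → Bool) ℂ) →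
    Matrix (ι → Bool) (ι → Bool) ℂ
  | 0, _ => 1
  | d + 1, U => U (Fin.last d) * circuitUnitary d (fun i => U i.castSucc)

/-- **No noise, `γ = 0`**: the evolved state is `C ρ C†` with `C = U_{d-1} ⋯ U_0`.
[cite: AharonovEtAl2023, Definition 1] -/
theorem noisyEvolve_rate_zero :
    ∀ (d : ℕ) (U : Fin d → Matrix (ι → Bool) (ι → Bool) ℂ) (ρ : Matrix (ι → Bool) (ι → Bool) ℂ),
      noisyEvolve 0 d U ρ = circuitUnitary d U * ρ * (circuitUnitary d U)ᴴ := by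
  intro d
  induction d with
  | zero => intro U ρ; simp [circuitUnitary]
  | succ d ih =>
    intro U ρ
    rw [noisyEvolve_succ_layers, depolarizeAll_rate_zero, ih]
    simp only [circuitUnitary, Matrix.conjTranspose_mul, Matrix.mul_assoc]

/-- At `γ = 0` the value is the noiseless expectation `Tr(O · C ρ C†)`; hence (Definition 1)
`Tr(O · C ρ C†) = Σ_s f(C,s,·)` by `noisyValue_eq_sum_pathCoeff`. [cite: AharonovEtAl2023, Definition 1] -/
theorem noisyValue_rate_zero {d : ℕ} (U : Fin d → Matrix (ι → Bool) (ι → Bool) ℂ)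
    (ρ O : Matrix (ι → Bool) (ι → Bool) ℂ) :
    noisyValue 0 U ρ O = (O * (circuitUnitary d U * ρ * (circuitUnitary d U)ᴴ)).trace := by
  rw [noisyValue, noisyEvolve_rate_zero, depolarizeAll_rate_zero]

/-- The projector `|x⟩⟨x|` onto a computational basis state of the register. [folklore] -/
def proj (x : ι → Bool) : Matrix (ι → Bool) (ι → Bool) ℂ :=
  Matrix.of fun a b => if a = x ∧ b = x then 1 else 0

omit [DecidableEq ι] in
/-- Entries of `proj` (`|x⟩⟨x|`, the operator ket `|x⟩⟩` of Table 1 (c)). [cite: AharonovEtAl2023, §2 (Table 1)] -/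
@[simp] theorem proj_apply (x a b : ι → Bool) : proj x a b = if a = x ∧ b = x then 1 else 0 := rfl

/-- `Tr(|x⟩⟨x| M) = M_{xx}` (`⟨⟨x|M⟩⟩ = ⟨x|M|x⟩`). [cite: AharonovEtAl2023, §2 (Table 1)] -/
theorem trace_proj_mul (x : ι → Bool) (M : Matrix (ι → Bool) (ι → Bool) ℂ) :
    (proj x * M).trace = M x x := by
  rw [Matrix.trace]
  simp only [Matrix.diag_apply, Matrix.mul_apply, proj_apply, ite_mul, one_mul, zero_mul]
  rw [Finset.sum_eq_single x]
  · rw [Finset.sum_eq_single x]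
    · simp
    · intro b _ hb; simp [hb]
    · intro h; exact absurd (Finset.mem_univ x) h
  · intro a _ ha; simp [ha]
  · intro h; exact absurd (Finset.mem_univ x) h

/-- **Definition 1 for a pure input** (`ρ = |ψ⟩⟨ψ|`, `O = |x⟩⟨x|`): the noiseless value is the Born
probability `p(C,x) = |⟨x|C|ψ⟩|²`, which `noisyValue_eq_sum_pathCoeff` writes as `Σ_s f(C,s,x)`
(the source takes `ψ = |0ⁿ⟩`). [cite: AharonovEtAl2023, Definition 1 (p(C,x) = |⟨x|C|0ⁿ⟩|²)] -/
theorem noisyValue_rate_zero_proj_pure {d : ℕ} (U : Fin d → Matrix (ι → Bool) (ι → Bool) ℂ)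
    (ψ : (ι → Bool) → ℂ) (x : ι → Bool) :
    noisyValue 0 U (Matrix.vecMulVec ψ (star ψ)) (proj x) =
      (circuitUnitary d U *ᵥ ψ) x * star ((circuitUnitary d U *ᵥ ψ) x) := by
  rw [noisyValue_rate_zero, trace_proj_mul]
  set W := circuitUnitary d U
  simp only [Matrix.mul_apply, Matrix.conjTranspose_apply, Matrix.vecMulVec_apply, Matrix.mulVec,
    dotProduct, Pi.star_apply, star_sum, star_mul', Finset.sum_mul, Finset.mul_sum]
  refine Finset.sum_congr rfl fun a _ => Finset.sum_congr rfl fun b _ => ?_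
  ring

/-! ### Properties of the Fourier coefficients: reality, the bound `|f| ≤ 2^{-n}`, the sign in `x` -/

/-- `Tr(A B)` is real (conjugation-invariant) for Hermitian `A`, `B`. [folklore] -/
private theorem conj_trace_mul_of_conjTranspose {A B : Matrix (ι → Bool) (ι → Bool) ℂ}
    (hA : Aᴴ = A) (hB : Bᴴ = B) : (starRingEnd ℂ) (A * B).trace = (A * B).trace := by
  rw [starRingEnd_apply, ← Matrix.trace_conjTranspose, Matrix.conjTranspose_mul, hA, hB,
    Matrix.trace_mul_comm]

/-- The noiseless transition amplitude `Tr(T · U S U†)` is REAL for every matrix `U` (both factors are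
Hermitian). [cite: AharonovEtAl2023, §2 (after Definition 2: "f(C,s,x) ∈ ℝ")] -/
theorem conj_transAmp_zero (U : Matrix (ι → Bool) (ι → Bool) ℂ) (S T : ι → Pauli) :
    (starRingEnd ℂ) (transAmp 0 U S T) = transAmp 0 U S T := by
  rw [transAmp, depolarizeAll_rate_zero]
  refine conj_trace_mul_of_conjTranspose (conjTranspose_pauliString T) ?_
  rw [Matrix.conjTranspose_mul, Matrix.conjTranspose_mul, Matrix.conjTranspose_conjTranspose,
    conjTranspose_pauliString, Matrix.mul_assoc]

/-- **`f(C,s,x) ∈ ℝ`**: for Hermitian read-out `O` and input `ρ` (in particular `|x⟩⟨x|` and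
`|0ⁿ⟩⟨0ⁿ|`) the Fourier coefficient of every path is real, whatever the layer matrices.
[cite: AharonovEtAl2023, §2 (after Definition 2: "The Fourier coefficients satisfy f(C,s,x) ∈ ℝ")] -/
theorem conj_pathCoeff_zero {d : ℕ} (U : Fin d → Matrix (ι → Bool) (ι → Bool) ℂ)
    {ρ O : Matrix (ι → Bool) (ι → Bool) ℂ} (hρ : ρᴴ = ρ) (hO : Oᴴ = O)
    (s : Fin (d + 1) → ι → Pauli) :
    (starRingEnd ℂ) (pathCoeff 0 U ρ O s) = pathCoeff 0 U ρ O s := by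
  rw [pathCoeff, depolarizeAll_rate_zero]
  simp only [map_mul, map_pow, map_inv₀, map_prod, map_ofNat, conj_transAmp_zero,
    conj_trace_mul_of_conjTranspose hO (conjTranspose_pauliString _),
    conj_trace_mul_of_conjTranspose (conjTranspose_pauliString _) hρ]

/-- Hence `f(C,s,x)` has zero imaginary part. [cite: AharonovEtAl2023, §2 (after Definition 2: "f(C,s,x) ∈ ℝ")] -/
theorem pathCoeff_zero_im {d : ℕ} (U : Fin d → Matrix (ι → Bool) (ι → Bool) ℂ)
    {ρ O : Matrix (ι → Bool) (ι → Bool) ℂ} (hρ : ρᴴ = ρ) (hO : Oᴴ = O)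
    (s : Fin (d + 1) → ι → Pauli) : (pathCoeff 0 U ρ O s).im = 0 :=
  Complex.conj_eq_iff_im.mp (conj_pathCoeff_zero U hρ hO s)

/-- `Tr 1 = 2^{|ι|}` on the register. [folklore] -/
private theorem trace_one_register :
    (1 : Matrix (ι → Bool) (ι → Bool) ℂ).trace = (2 : ℂ) ^ Fintype.card ι := by
  rw [Matrix.trace_one, Fintype.card_fun, Fintype.card_bool]
  push_cast
  rfl

/-- **One transition amplitude is bounded by `2^{|ι|}`** for a UNITARY layer:
`|Tr(T · U S U†)| ≤ 2^{|ι|}`, i.e. `|⟨⟨t|𝒰|s⟩⟩| ≤ 1` in normalised Paulis (Cauchy–Schwarz for the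
Hilbert–Schmidt inner product, `Tr(T T†) = Tr((USU†)† USU†) = 2^{|ι|}`).
[cite: AharonovEtAl2023, §2 (after Definition 2: |f(C,s,x)| ≤ 1/2ⁿ)] -/
theorem norm_transAmp_zero_le {U : Matrix (ι → Bool) (ι → Bool) ℂ}
    (hU : U ∈ Matrix.unitaryGroup (ι → Bool) ℂ) (S T : ι → Pauli) :
    ‖transAmp 0 U S T‖ ≤ (2 : ℝ) ^ Fintype.card ι := by
  have hUU : Uᴴ * U = 1 := by
    simpa only [star_eq_conjTranspose] using Matrix.mem_unitaryGroup_iff'.mp hU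
  rw [transAmp, depolarizeAll_rate_zero]
  refine (Literature.MathematicalPhysics.QuantumLattice.norm_trace_mul_le_sqrt_mul_sqrt _ _).trans ?_
  have h1 : (pauliString T * (pauliString T)ᴴ).trace.re = (2 : ℝ) ^ Fintype.card ι := by
    rw [conjTranspose_pauliString, pauliString_mul_self, trace_one_register]
    norm_cast
  have h2 : ((U * pauliString S * Uᴴ)ᴴ * (U * pauliString S * Uᴴ)).trace.re =
      (2 : ℝ) ^ Fintype.card ι := by
    have : (U * pauliString S * Uᴴ)ᴴ * (U * pauliString S * Uᴴ) = 1 := by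
      rw [Matrix.conjTranspose_mul, Matrix.conjTranspose_mul, Matrix.conjTranspose_conjTranspose,
        conjTranspose_pauliString]
      calc U * (pauliString S * Uᴴ) * (U * pauliString S * Uᴴ)
          = U * (pauliString S * (Uᴴ * U) * pauliString S) * Uᴴ := by
            simp only [Matrix.mul_assoc]
        _ = 1 := by
            rw [hUU, Matrix.mul_one, pauliString_mul_self, Matrix.mul_one]
            simpa only [star_eq_conjTranspose] using Matrix.mem_unitaryGroup_iff.mp hU
    rw [this, trace_one_register]
    norm_cast
  rw [h1, h2, Real.mul_self_sqrt (by positivity)]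

omit [Fintype ι] [DecidableEq ι] in
/-- A diagonal entry of a one-qubit Pauli matrix has norm at most `1`. [folklore] -/
private theorem norm_mat_apply_self_le_one (Q : Pauli) (b : Bool) : ‖Q.mat b b‖ ≤ 1 := by
  cases Q <;> cases b <;> simp

/-- The read-out bracket of a basis projector against a Pauli string is a diagonal entry of the string,
of modulus `≤ 1`: `|Tr(|x⟩⟨x| S)| = |S_{xx}| ≤ 1` (`⟨⟨x|s⟩⟩ ∈ {0, ±1/√2ⁿ}` in normalised Paulis).
[cite: AharonovEtAl2023, §2 (after Definition 2: ⟨⟨x|s⟩⟩ ∈ {0, −1/√2ⁿ, 1/√2ⁿ})] -/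
theorem norm_trace_proj_mul_pauliString_le_one (x : ι → Bool) (S : ι → Pauli) :
    ‖(proj x * pauliString S).trace‖ ≤ 1 := by
  rw [trace_proj_mul, pauliString_eq, tensorAll_apply, norm_prod]
  exact Finset.prod_le_one (fun i _ => norm_nonneg _) fun i _ => norm_mat_apply_self_le_one _ _

/-- The input bracket `|Tr(S |y⟩⟨y|)| ≤ 1`. [cite: AharonovEtAl2023, §2 (after Definition 2)] -/
theorem norm_trace_pauliString_mul_proj_le_one (S : ι → Pauli) (y : ι → Bool) :
    ‖(pauliString S * proj y).trace‖ ≤ 1 := by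
  rw [Matrix.trace_mul_comm]
  exact norm_trace_proj_mul_pauliString_le_one y S

/-- **`|f(C,s,x)| ≤ 1/2ⁿ`** for unitary layers, basis-state input `|y⟩⟨y|` and read-out `|x⟩⟨x|`
(the source's `y = 0ⁿ`): each of the `d` transition amplitudes is `≤ 1`, the two end brackets are
`≤ 1/√2ⁿ` in normalised Paulis. [cite: AharonovEtAl2023, §2 (after Definition 2: "|f(C,s,x)| ≤ 1/2ⁿ")] -/
theorem norm_pathCoeff_zero_proj_le {d : ℕ} {U : Fin d → Matrix (ι → Bool) (ι → Bool) ℂ}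
    (hU : ∀ t, U t ∈ Matrix.unitaryGroup (ι → Bool) ℂ) (x y : ι → Bool)
    (s : Fin (d + 1) → ι → Pauli) :
    ‖pathCoeff 0 U (proj y) (proj x) s‖ ≤ ((2 : ℝ) ^ Fintype.card ι)⁻¹ := by
  have h2 : (0 : ℝ) < (2 : ℝ) ^ Fintype.card ι := by positivity
  have hP : ‖∏ t : Fin d, transAmp 0 (U t) (s t.castSucc) (s t.succ)‖ ≤
      ((2 : ℝ) ^ Fintype.card ι) ^ d := by
    rw [norm_prod]
    calc ∏ t : Fin d, ‖transAmp 0 (U t) (s t.castSucc) (s t.succ)‖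
        ≤ ∏ _t : Fin d, (2 : ℝ) ^ Fintype.card ι :=
          Finset.prod_le_prod (fun t _ => norm_nonneg _) fun t _ => norm_transAmp_zero_le (hU t) _ _
      _ = ((2 : ℝ) ^ Fintype.card ι) ^ d := by
          rw [Finset.prod_const, Finset.card_univ, Fintype.card_fin]
  rw [pathCoeff, depolarizeAll_rate_zero, norm_mul, norm_mul, norm_mul, norm_pow, norm_inv, norm_pow,
    Complex.norm_two]
  calc (((2 : ℝ) ^ Fintype.card ι)⁻¹) ^ (d + 1) *
        (‖(proj x * pauliString (s (Fin.last d))).trace‖ *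
          ‖∏ t : Fin d, transAmp 0 (U t) (s t.castSucc) (s t.succ)‖ *
            ‖(pauliString (s 0) * proj y).trace‖)
      ≤ (((2 : ℝ) ^ Fintype.card ι)⁻¹) ^ (d + 1) * (1 * ((2 : ℝ) ^ Fintype.card ι) ^ d * 1) := by
        apply mul_le_mul_of_nonneg_left _ (by positivity)
        exact mul_le_mul (mul_le_mul (norm_trace_proj_mul_pauliString_le_one _ _) hP
          (norm_nonneg _) zero_le_one) (norm_trace_pauliString_mul_proj_le_one _ _)
          (norm_nonneg _) (by positivity)
    _ = ((2 : ℝ) ^ Fintype.card ι)⁻¹ := by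
        rw [one_mul, mul_one, pow_succ', mul_assoc, ← mul_pow, inv_mul_cancel₀ h2.ne', one_pow,
          mul_one]

omit [Fintype ι] [DecidableEq ι] in
/-- The square of a diagonal entry of a one-qubit Pauli matrix does not depend on the entry:
`(σ_Q)_{bb}² = [Q ∈ {I, Z}]`. [folklore] -/
private theorem mat_apply_self_sq (Q : Pauli) (b : Bool) :
    (Q.mat b b) ^ 2 = if Q = Pauli.I ∨ Q = Pauli.Z then 1 else 0 := by
  cases Q <;> cases b <;> simp

/-- The read-out bracket squared does not depend on the basis state: `Tr(|x⟩⟨x| S)² = Tr(|y⟩⟨y| S)²`.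
[cite: AharonovEtAl2023, §2 (after Definition 2: "the output x only affects the sign")] -/
theorem trace_proj_mul_pauliString_sq (x y : ι → Bool) (S : ι → Pauli) :
    (proj x * pauliString S).trace ^ 2 = (proj y * pauliString S).trace ^ 2 := by
  rw [trace_proj_mul, trace_proj_mul, pauliString_eq, tensorAll_apply, tensorAll_apply,
    ← Finset.prod_pow, ← Finset.prod_pow]
  simp only [mat_apply_self_sq]

/-- **`f(C,s,x)² = f(C,s,0ⁿ)²`**: "the output `x` only affects the sign of the Fourier coefficient" —
for any layer matrices and any input `ρ`, the squares of the coefficients read out at two basis states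
agree. [cite: AharonovEtAl2023, §2 (display after "only affects the sign": f(C,s,x)² = f(C,s,0ⁿ)²)] -/
theorem pathCoeff_zero_proj_sq {d : ℕ} (U : Fin d → Matrix (ι → Bool) (ι → Bool) ℂ)
    (ρ : Matrix (ι → Bool) (ι → Bool) ℂ) (x y : ι → Bool) (s : Fin (d + 1) → ι → Pauli) :
    pathCoeff 0 U ρ (proj x) s ^ 2 = pathCoeff 0 U ρ (proj y) s ^ 2 := by
  simp only [pathCoeff, depolarizeAll_rate_zero, mul_pow,
    trace_proj_mul_pauliString_sq x y (s (Fin.last d))]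

/-! ### Gate-set orthogonality from Pauli randomness (Lemma 2 of the source, finite core)

"Lemma 2 (Gate-set orthogonality). Let `𝒟` be any distribution over `𝕌(4)` that is invariant under
right-multiplication of random Pauli … Then for any `P, Q ∈ {I,X,Y,Z}²` such that `P ≠ Q`, we have
`E_{U∼𝒟}[U P U† ⊗ U Q U†] = 0`." Its proof: "it suffices to prove that
`E_{V∼{I,X,Y,Z}²}[V P V† ⊗ V Q V†] = 0` if `P ≠ Q`" via `V P V† = (−1)^{⟨V,P⟩} P`. Below: the
conjugation table for strings on ANY finite register (`pauliString_conj_pauliString`), the character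
orthogonality `Σ_V sign_V(P) sign_V(Q) = 4^{|ι|}[P = Q]`, the printed display for the uniform Pauli
ensemble (`sum_conj_kronecker_conj_eq_zero`) and its push-forward under any fixed matrix `U`
(the ensemble `U·V`, `V` uniform — "invariance under right-multiplication … and linearity"), and the
scalar form used for products of two transition amplitudes. Sums over `V` replace the expectation
(divide by `4^{|ι|}`). -/

omit [DecidableEq ι] in
/-- Scalars pull out of `tensorAll` factorwise: `⊗ᵢ (cᵢ Aᵢ) = (∏ᵢ cᵢ) ⊗ᵢ Aᵢ`. [folklore] -/
private theorem tensorAll_smul_each (c : ι → ℂ) (A : ι → Matrix Bool Bool ℂ) :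
    tensorAll (fun i => c i • A i) = (∏ i, c i) • tensorAll A := by
  ext x y
  simp only [tensorAll_apply, Matrix.smul_apply, smul_eq_mul, Finset.prod_mul_distrib]

/-- **Conjugating a Pauli string by a Pauli string**: `V S V = (∏ᵢ sign(Vᵢ, Sᵢ)) S`, the sign being
`−1` exactly at the wires where `Vᵢ` and `Sᵢ` anticommute (`V P V† = (−1)^{⟨V,P⟩} P`).
[cite: AharonovEtAl2023, §2 (proof of Lemma 2)] -/
theorem pauliString_conj_pauliString (V S : ι → Pauli) :
    pauliString V * pauliString S * pauliString V = (∏ i, Pauli.sign (V i) (S i)) • pauliString S := by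
  rw [pauliString_eq, pauliString_eq, tensorAll_mul, tensorAll_mul, ← tensorAll_smul_each]
  congr 1
  funext i
  exact Pauli.mat_mul_mat_mul_mat (V i) (S i)

omit [Fintype ι] [DecidableEq ι] in
/-- One-qubit character orthogonality: `Σ_{V ∈ {I,X,Y,Z}} sign(V,P) sign(V,Q) = 4 [P = Q]` ("PQ is not
identity, and therefore commutes with half Paulis and anticommutes with the other half").
[cite: AharonovEtAl2023, §2 (proof of Lemma 2)] -/
theorem sum_sign_mul_sign (P Q : Pauli) :
    ∑ V, Pauli.sign V P * Pauli.sign V Q = if P = Q then 4 else 0 := by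
  rw [Pauli.sum_univ]
  cases P <;> cases Q <;> simp [Pauli.sign] <;> norm_num

/-- Character orthogonality for strings: `Σ_{V ∈ {I,X,Y,Z}^ι} (∏ sign(Vᵢ,Pᵢ)) (∏ sign(Vᵢ,Qᵢ)) = 4^{|ι|} [P = Q]`.
[cite: AharonovEtAl2023, §2 (proof of Lemma 2)] -/
theorem sum_prod_sign_mul_prod_sign (P Q : ι → Pauli) :
    ∑ V : ι → Pauli, (∏ i, Pauli.sign (V i) (P i)) * (∏ i, Pauli.sign (V i) (Q i)) =
      if P = Q then (4 : ℂ) ^ Fintype.card ι else 0 := by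
  simp only [← Finset.prod_mul_distrib]
  rw [← Fintype.prod_sum (fun i V => Pauli.sign V (P i) * Pauli.sign V (Q i))]
  simp only [sum_sign_mul_sign]
  by_cases h : P = Q
  · subst h
    simp [Finset.prod_const, Finset.card_univ]
  · rw [if_neg h]
    obtain ⟨i, hi⟩ : ∃ i, P i ≠ Q i := by
      by_contra hc
      push Not at hc
      exact h (funext hc)
    exact Finset.prod_eq_zero (Finset.mem_univ i) (if_neg hi)

/-- **Lemma 2, the display of its proof** (uniform Pauli ensemble on a finite register):
`Σ_{V ∈ {I,X,Y,Z}^ι} V P V ⊗ V Q V = 0` for Pauli strings `P ≠ Q` (divide by `4^{|ι|}` for the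
expectation). [cite: AharonovEtAl2023, Lemma 2 (proof, first display)] -/
theorem sum_conj_kronecker_conj_eq_zero {P Q : ι → Pauli} (hPQ : P ≠ Q) :
    ∑ V : ι → Pauli, Matrix.kroneckerMap (· * ·) (pauliString V * pauliString P * pauliString V)
      (pauliString V * pauliString Q * pauliString V) = 0 := by
  simp only [pauliString_conj_pauliString]
  have h : ∀ V : ι → Pauli,
      Matrix.kroneckerMap (· * ·) ((∏ i, Pauli.sign (V i) (P i)) • pauliString P)
        ((∏ i, Pauli.sign (V i) (Q i)) • pauliString Q) =
      ((∏ i, Pauli.sign (V i) (P i)) * ∏ i, Pauli.sign (V i) (Q i)) •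
        Matrix.kroneckerMap (· * ·) (pauliString P) (pauliString Q) := by
    intro V
    rw [Matrix.smul_kronecker, Matrix.kronecker_smul, smul_smul]
  simp only [h, ← Finset.sum_smul, sum_prod_sign_mul_prod_sign, if_neg hPQ, zero_smul]

/-- **Lemma 2 for the Pauli-twirled ensemble `U·V`** (`U` any fixed matrix, `V` uniform over the Pauli
strings — a distribution "invariant under right-multiplication of random Pauli"; `(UV) P (UV)† =
U (V P V) U†` since `V† = V`): `Σ_V (UV)P(UV)† ⊗ (UV)Q(UV)† = 0` for `P ≠ Q`.
[cite: AharonovEtAl2023, Lemma 2] -/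
theorem sum_conj_kronecker_conj_eq_zero_of_twirl (U : Matrix (ι → Bool) (ι → Bool) ℂ)
    {P Q : ι → Pauli} (hPQ : P ≠ Q) :
    ∑ V : ι → Pauli, Matrix.kroneckerMap (· * ·)
      (U * (pauliString V * pauliString P * pauliString V) * Uᴴ)
      (U * (pauliString V * pauliString Q * pauliString V) * Uᴴ) = 0 := by
  simp only [pauliString_conj_pauliString, Matrix.mul_smul, Matrix.smul_mul]
  have h : ∀ V : ι → Pauli,
      Matrix.kroneckerMap (· * ·) ((∏ i, Pauli.sign (V i) (P i)) • (U * pauliString P * Uᴴ))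
        ((∏ i, Pauli.sign (V i) (Q i)) • (U * pauliString Q * Uᴴ)) =
      ((∏ i, Pauli.sign (V i) (P i)) * ∏ i, Pauli.sign (V i) (Q i)) •
        Matrix.kroneckerMap (· * ·) (U * pauliString P * Uᴴ) (U * pauliString Q * Uᴴ) := by
    intro V
    rw [Matrix.smul_kronecker, Matrix.kronecker_smul, smul_smul]
  simp only [h, ← Finset.sum_smul, sum_prod_sign_mul_prod_sign, if_neg hPQ, zero_smul]

/-- **Scalar form** (the one entering products of two path contributions): for read-outs `A, B`, any
layer matrix `U` and input strings `P ≠ Q`, the Pauli-twirl average of the product of the two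
transition brackets vanishes, `Σ_V Tr(A·(UV)P(UV)†) Tr(B·(UV)Q(UV)†) = 0` — "on average over random
circuits the product of the contributions from two different Pauli paths equals 0".
[cite: AharonovEtAl2023, §1.1 (orthogonality) and Lemma 2] -/
theorem sum_trace_conj_mul_trace_conj_eq_zero (A B U : Matrix (ι → Bool) (ι → Bool) ℂ)
    {P Q : ι → Pauli} (hPQ : P ≠ Q) :
    ∑ V : ι → Pauli, (A * (U * (pauliString V * pauliString P * pauliString V) * Uᴴ)).trace *
      (B * (U * (pauliString V * pauliString Q * pauliString V) * Uᴴ)).trace = 0 := by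
  simp only [pauliString_conj_pauliString, Matrix.mul_smul, Matrix.smul_mul, Matrix.trace_smul,
    smul_eq_mul]
  have h : ∀ V : ι → Pauli,
      (∏ i, Pauli.sign (V i) (P i)) * (A * (U * pauliString P * Uᴴ)).trace *
        ((∏ i, Pauli.sign (V i) (Q i)) * (B * (U * pauliString Q * Uᴴ)).trace) =
      ((∏ i, Pauli.sign (V i) (P i)) * ∏ i, Pauli.sign (V i) (Q i)) *
        ((A * (U * pauliString P * Uᴴ)).trace * (B * (U * pauliString Q * Uᴴ)).trace) := by
    intro V; ring
  simp only [h, ← Finset.sum_mul, sum_prod_sign_mul_prod_sign, if_neg hPQ, zero_mul]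

/-- The diagonal case: for `P = Q` the same average is the full weight `4^{|ι|} · Tr(A·UPU†) Tr(B·UPU†)`
(the twirl does not damp a matched pair of paths). [cite: AharonovEtAl2023, Lemma 1 (second display, the matched case) and Lemma 2] -/
theorem sum_trace_conj_mul_trace_conj_self (A B U : Matrix (ι → Bool) (ι → Bool) ℂ) (P : ι → Pauli) :
    ∑ V : ι → Pauli, (A * (U * (pauliString V * pauliString P * pauliString V) * Uᴴ)).trace *
      (B * (U * (pauliString V * pauliString P * pauliString V) * Uᴴ)).trace =
      (4 : ℂ) ^ Fintype.card ι *
        ((A * (U * pauliString P * Uᴴ)).trace * (B * (U * pauliString P * Uᴴ)).trace) := by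
  simp only [pauliString_conj_pauliString, Matrix.mul_smul, Matrix.smul_mul, Matrix.trace_smul,
    smul_eq_mul]
  have h : ∀ V : ι → Pauli,
      (∏ i, Pauli.sign (V i) (P i)) * (A * (U * pauliString P * Uᴴ)).trace *
        ((∏ i, Pauli.sign (V i) (P i)) * (B * (U * pauliString P * Uᴴ)).trace) =
      ((∏ i, Pauli.sign (V i) (P i)) * ∏ i, Pauli.sign (V i) (P i)) *
        ((A * (U * pauliString P * Uᴴ)).trace * (B * (U * pauliString P * Uᴴ)).trace) := by
    intro V; ring
  simp only [h, ← Finset.sum_mul, sum_prod_sign_mul_prod_sign, if_true]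

end PauliPath

end Literature.Computability.QuantumComplexity
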